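import Literature.AlgebraicGeometry.HodgeTheory.ComplexOrientationDegreeFibre
import HarnessLib

/-!
# Any chart HOLOMORPHICALLY compatible with the algebraic atlas computes the complex orientation of `X(ℂ)`

Family `hodge`, layer `Literature/AlgebraicGeometry/HodgeTheory`, sub-namespace
`…HodgeTheory.SmoothFamilyFibreClass`. THEOREMS ONLY (no definition, no named fact). Second file of the
Literature home of the discharge of `Fulton1998_map_fundamentalClass_fibre_eq`
(`SmoothFamilyFibreClasses`; apex `SmoothFamilyFibreClassesHolds`).

The complex orientation of `X(ℂ)` (`HodgeTheory/ComplexOrientationFamily`: the `ℤ`-orientation of the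
POSITIVE atlas of holomorphic algebraic charts, Bredon VI.7 / Milnor–Stasheff §13 p. 151) is defined through
the charts `chartAt P = (algebraicChart X n P) ∘ (ℂⁿ ≃ ℝ²ⁿ)` of the atlas only. To compare the orientations
of DIFFERENT fibres of a family one needs charts that are not in the atlas (holomorphic coordinates induced
from the total space); this file records that they compute the same local classes:

* `positiveAtlasOrientation_localClass_eq_of_hasFDerivAt_chart` — on any charted space with a positive
  atlas, a partial homeomorphism `c' : X ⇀ ℝᵏ` at `y` whose transition to the atlas chart at `y` is
  differentiable at `c' y` with Jacobian of positive determinant has the same reference class at `y` as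
  the atlas: `μ_y = c'^* g_{c' y}` (the tree's `chartXEquiv_symm_localClass_eq_of_hasFDerivAt`, sign `+1`);
* `complexPoints_localClass_eq_of_holomorphicChart` — for `X` smooth of relative dimension `n`, separated and
  locally of finite type over `ℂ`, `P ∈ X(ℂ)` and an open partial homeomorphism `T : ℂⁿ ⇀ ℂⁿ` defined at
  `a_P(P)` whose INVERSE is `ℂ`-differentiable at `T(a_P P)` with invertible derivative (e.g. the local
  inverse of a holomorphic map with invertible differential), the chart `(a_P ≫ T) ∘ (ℂⁿ ≃ ℝ²ⁿ)` of `X(ℂ)`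
  computes the complex local orientation class at `P` (real Jacobian `|det_ℂ|² > 0`,
  `det_restrictScalars_eq_normSq`).

Provenance: Literature home of the Summits-side `Theorems/Ring2AbelianAllAndreHolomorphicChartOrientation`
(cell Ring 2 · AbelianAll, André axis), which `Literature/` may not import. Lane `lit-hodgefound`, seat p20.

## References

* [Bredon1993] G. E. Bredon, Topology and Geometry, GTM 139, Springer 1993, VI.7.
* [MilnorStasheff1974] J. Milnor, J. Stasheff, Characteristic Classes, PUP 1974, §13 p. 151.
* [HatcherAT2002] A. Hatcher, Algebraic Topology, CUP 2002, §3.3 p. 233.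
* [SerreGAGA1956] J.-P. Serre, GAGA, Ann. Inst. Fourier 6 (1956), §2 n°5 Prop. 2.
-/

noncomputable section

open CategoryTheory AlgebraicGeometry Set Filter Topology
open scoped ContDiff
open Literature.AlgebraicGeometry Literature.AlgebraicGeometry.Motives
open Literature.AlgebraicGeometry.HodgeTheory
open Literature.AlgebraicTopology.SingularHomology Literature.Topology.FourManifolds

namespace Literature.AlgebraicGeometry.HodgeTheory.SmoothFamilyFibreClass

universe u

/-! ## §1 Charts positively compatible with a positive atlas compute its orientation -/

section PositiveAtlas

variable {k : ℕ} {X : Type u} [TopologicalSpace X] [T2Space X] [ChartedSpace (EuclideanSpace ℝ (Fin k)) X]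

/-- **A chart positively compatible with the atlas computes the positive-atlas orientation**: if the
transition `(chartAt y) ∘ c'⁻¹` is differentiable at `c' y` with a Jacobian of positive determinant, then
`μ_y = c'^* g_{c' y}` for `μ = positiveAtlasOrientation hX g` (Bredon VI.7: change of chart is the sign of
the Jacobian — the tree's `chartXEquiv_symm_localClass_eq_of_hasFDerivAt`). [cite: Bredon1993, VI.7]
[cite: HatcherAT2002, §3.3 p. 233] -/
theorem positiveAtlasOrientation_localClass_eq_of_hasFDerivAt_chart (hX : IsPositiveAtlas k X)
    (g : HomologicalOrientation ℤ (EuclideanSpace ℝ (Fin k)) k)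
    (c' : OpenPartialHomeomorph X (EuclideanSpace ℝ (Fin k))) {y : X} (hy' : y ∈ c'.source)
    {A : EuclideanSpace ℝ (Fin k) →L[ℝ] EuclideanSpace ℝ (Fin k)}
    (hA : HasFDerivAt (fun v => chartAt (EuclideanSpace ℝ (Fin k)) y (c'.symm v)) A (c' y))
    (hdet : 0 < LinearMap.det (A : EuclideanSpace ℝ (Fin k) →ₗ[ℝ] EuclideanSpace ℝ (Fin k))) :
    (positiveAtlasOrientation hX g).localClass y =
      (localHomology.chartXEquiv ℤ ℤ c' hy' k).symm (g.localClass (c' y)) := by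
  rw [positiveAtlasOrientation_localClass_eq hX g (chart_mem_atlas (EuclideanSpace ℝ (Fin k)) y)
      (mem_chart_source (EuclideanSpace ℝ (Fin k)) y),
    chartXEquiv_symm_localClass_eq_of_hasFDerivAt g (chartAt (EuclideanSpace ℝ (Fin k)) y) c'
      (mem_chart_source (EuclideanSpace ℝ (Fin k)) y) hy' hA hdet.ne', if_pos hdet]

end PositiveAtlas

/-! ## §2 Holomorphic charts of `X(ℂ)` compute the complex orientation -/

section ComplexPoints

variable {n : ℕ} {X : SchemeOver ℂ} [LocallyOfFiniteType X.hom] [SmoothOfRelativeDimension n X.hom]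
  [IsSeparated X.hom]

/-- **A chart of `X(ℂ)` holomorphically compatible with the algebraic atlas computes the complex local
orientation class.** Let `P ∈ X(ℂ)`, `a_P = algebraicChart X n P`, and `T : ℂⁿ ⇀ ℂⁿ` an open partial
homeomorphism with `a_P P ∈ T.source` whose inverse is `ℂ`-differentiable at `T (a_P P)` with an invertible
`ℂ`-linear derivative `B`. Then for the chart `c' = (a_P ≫ T) ∘ (ℂⁿ ≃ ℝ²ⁿ)` of `X(ℂ)` at `P`,
`μ_P = c'^* g_{c' P}` for the positive-atlas orientation `μ` of the holomorphic algebraic atlas (the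
transition to `chartAt P = a_P ∘ (ℂⁿ ≃ ℝ²ⁿ)` is `T⁻¹` conjugated by the real-linear `ℂⁿ ≃ ℝ²ⁿ`, of real
Jacobian determinant `|det_ℂ B|² > 0`; Milnor–Stasheff §13 p. 151). [cite: MilnorStasheff1974, §13 p. 151]
[cite: Bredon1993, VI.7] [cite: SerreGAGA1956, §2 n°5 Prop. 2] -/
theorem complexPoints_localClass_eq_of_holomorphicChart
    (g : HomologicalOrientation ℤ (EuclideanSpace ℝ (Fin (2 * n))) (2 * n)) (P : ComplexPoints X)
    (T : OpenPartialHomeomorph (Fin n → ℂ) (Fin n → ℂ))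
    (hT : ComplexPoints.algebraicChart X n P P ∈ T.source) {B : (Fin n → ℂ) ≃L[ℂ] (Fin n → ℂ)}
    (hB : HasFDerivAt T.symm (B : (Fin n → ℂ) →L[ℂ] (Fin n → ℂ))
      (T (ComplexPoints.algebraicChart X n P P)))
    (hP' : P ∈ (((ComplexPoints.algebraicChart X n P).trans T).transHomeomorph
      (complexToEuclidean n)).source) :
    letI := ComplexPoints.chartedSpace X n
    haveI := ComplexPoints.t2Space_of_isSeparated X
    (positiveAtlasOrientation (isPositiveAtlas_complexPoints_of_smooth X n) g).localClass P =
      (localHomology.chartXEquiv ℤ ℤ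
          (((ComplexPoints.algebraicChart X n P).trans T).transHomeomorph (complexToEuclidean n))
          hP' (2 * n)).symm
        (g.localClass ((((ComplexPoints.algebraicChart X n P).trans T).transHomeomorph
          (complexToEuclidean n)) P)) := by
  letI := ComplexPoints.chartedSpace X n
  haveI := ComplexPoints.t2Space_of_isSeparated X
  set a := ComplexPoints.algebraicChart X n P with ha
  set L := complexToEuclideanCLE n with hL
  set c' := (a.trans T).transHomeomorph (complexToEuclidean n) with hc'
  have hPa : P ∈ a.source := ComplexPoints.mem_algebraicChart_source X n P
  -- the written-out transition near `c' P = L (T (a P))`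
  have hc'P : c' P = L (T (a P)) := rfl
  have hfun : ∀ v, chartAt (EuclideanSpace ℝ (Fin (2 * n))) P (c'.symm v) =
      L (a (a.symm (T.symm (L.symm v)))) := fun v => rfl
  -- near `c' P` the transition is `L ∘ T⁻¹ ∘ L⁻¹`
  have hTa : T (a P) ∈ T.target := T.map_source hT
  have hev : (fun v => chartAt (EuclideanSpace ℝ (Fin (2 * n))) P (c'.symm v)) =ᶠ[𝓝 (c' P)]
      fun v => L (T.symm (L.symm v)) := by
    have hW : {w : Fin n → ℂ | w ∈ T.target ∧ T.symm w ∈ a.target} ∈ 𝓝 (T (a P)) := by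
      have h1 : T.target ∈ 𝓝 (T (a P)) := T.open_target.mem_nhds hTa
      have h2 : T.symm ⁻¹' a.target ∈ 𝓝 (T (a P)) := by
        apply (T.continuousAt_symm hTa).preimage_mem_nhds
        rw [T.left_inv hT]
        exact a.open_target.mem_nhds (a.map_source hPa)
      exact Filter.inter_mem h1 h2
    have hW' : L.symm ⁻¹' {w : Fin n → ℂ | w ∈ T.target ∧ T.symm w ∈ a.target} ∈ 𝓝 (c' P) := by
      apply L.symm.continuous.continuousAt.preimage_mem_nhds
      rw [hc'P, L.symm_apply_apply]
      exact hW
    filter_upwards [hW'] with v hv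
    rw [hfun, a.right_inv hv.2]
  -- its derivative `L ∘ B ∘ L⁻¹` and the positivity of the determinant
  set A : EuclideanSpace ℝ (Fin (2 * n)) →L[ℝ] EuclideanSpace ℝ (Fin (2 * n)) :=
    (L : (Fin n → ℂ) →L[ℝ] _).comp (((B : (Fin n → ℂ) →L[ℂ] (Fin n → ℂ)).restrictScalars ℝ).comp
      (L.symm : _ →L[ℝ] (Fin n → ℂ))) with hA
  have hderiv : HasFDerivAt (fun v => chartAt (EuclideanSpace ℝ (Fin (2 * n))) P (c'.symm v)) A
      (c' P) := by
    refine HasFDerivAt.congr_of_eventuallyEq ?_ hev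
    rw [hc'P]
    have h1 : HasFDerivAt (fun v ↦ L.symm v) (L.symm : _ →L[ℝ] (Fin n → ℂ)) (L (T (a P))) :=
      L.symm.hasFDerivAt
    have h2 : HasFDerivAt T.symm ((B : (Fin n → ℂ) →L[ℂ] (Fin n → ℂ)).restrictScalars ℝ)
        (L.symm (L (T (a P)))) := by
      rw [L.symm_apply_apply]
      exact hB.restrictScalars ℝ
    have h3 : HasFDerivAt (fun u ↦ L u) (L : (Fin n → ℂ) →L[ℝ] _) (T.symm (L.symm (L (T (a P))))) :=
      L.hasFDerivAt
    exact h3.comp (L (T (a P))) (h2.comp (L (T (a P))) h1)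
  have hdet : 0 < LinearMap.det (A : EuclideanSpace ℝ (Fin (2 * n)) →ₗ[ℝ]
      EuclideanSpace ℝ (Fin (2 * n))) := by
    rw [hA, det_conj_continuousLinearEquiv]
    have hrs : ((((B : (Fin n → ℂ) →L[ℂ] (Fin n → ℂ)).restrictScalars ℝ : (Fin n → ℂ) →L[ℝ]
        (Fin n → ℂ)) : (Fin n → ℂ) →ₗ[ℝ] (Fin n → ℂ))) =
        ((B : (Fin n → ℂ) →L[ℂ] (Fin n → ℂ)) : (Fin n → ℂ) →ₗ[ℂ] (Fin n → ℂ)).restrictScalars ℝ := rfl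
    rw [hrs, det_restrictScalars_eq_normSq]
    refine Complex.normSq_pos.2 ?_
    have hu := (B : (Fin n → ℂ) ≃ₗ[ℂ] (Fin n → ℂ)).isUnit_det'
    exact hu.ne_zero
  exact positiveAtlasOrientation_localClass_eq_of_hasFDerivAt_chart
    (isPositiveAtlas_complexPoints_of_smooth X n) g c' hP' hderiv hdet

end ComplexPoints

end Literature.AlgebraicGeometry.HodgeTheory.SmoothFamilyFibreClass

end
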